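import Summits.NavierStokesRegularity.NavierStokesRegularity.Theses.ForcedAmplifier

/-!
# `ForcedAmplifier.Assembly` HOLDS (route `ForcedAmplifier`, decomp-ns node N31, negative board)

The assembly item `Assembly : AMP → QuantitativeGap → Bridge → NavierStokesBreakdownPeriodicPressurePeriodic`
(stmt-NavierStokesRegularity-28104) of route
`Summits/NavierStokesRegularity/NavierStokesRegularity/Theses/ForcedAmplifier.lean` is, by `rfl`
unfolding, the type of the route's gate-certified deciding theorem `ForcedAmplifier.closes` (D-0027 §2.1,
`closes_target` D-errata; audit `closes: OK`, authority native).  Pure logic: from `AMP ν` take the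
threshold `(A, T₀)`; `QuantitativeGap ν` applied to the putative regularity `SFR ν` and `(A, T₀)` yields a
bound `M`; `AMP` produces an episode exceeding `M` — contradiction — so `¬ SFR ν`, and `Bridge ν` turns
that into the `ν`-slice of D♯. [cite: Tao2013 «Localisation and compactness properties of the
Navier–Stokes global regularity problem», Conj. 1.8/1.10, Thm 1.20; FeffermanClay2006, (D) + errata]
-/

set_option linter.dupNamespace false

namespace Summit.NavierStokesRegularity.NavierStokesRegularity.Theorems.ForcedAmplifierAssembly

/-- **`Assembly` HOLDS**: the route's deciding theorem `closes`, read as a proof of the assembly item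
(stmt-NavierStokesRegularity-28104). -/
theorem assembly_holds : Theses.ForcedAmplifier.Assembly :=
  fun hAMP hQ hB => Theses.ForcedAmplifier.closes hAMP hQ hB

end Summit.NavierStokesRegularity.NavierStokesRegularity.Theorems.ForcedAmplifierAssembly
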